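import Literature.MathematicalPhysics.QuantumLattice.HubbardNNNHoppingInteractionTorus
import Literature.MathematicalPhysics.QuantumLattice.HubbardTorusLocalHamiltonianDecomposition
import HarnessLib

/-!
# The `t–t'` torus Hamiltonian near an embedded region: `H_L = Γ(H^{tt'}_{Λ'}) + (far terms)`,
# hence `[H_L, Γ A] = Γ([H^{tt'}_{Λ'}, A])`

Topic `Literature/MathematicalPhysics/QuantumLattice`. The `t–t'` companion of
`HubbardTorusLocalHamiltonianDecomposition.lean`. Pull a finite region `Λ' ⊆ ℤ²` back into the
fermionic torus `(ℤ/L)²` by `x ↦ x mod L` (`PolySite.toTorusEmb`, injective on `thicken Λ' 1`).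
The diagonal hopping Hamiltonian `hamiltonian (fermionTorusDiagGraph L) t' 0` of the torus splits
as the embedded free-boundary local Hamiltonian of the diagonal interaction
(`diagHoppingFermionInteraction t'`, `HubbardNNNHoppingInteraction.lean`) plus the diagonal bonds
of the torus not inside the image of `Λ'`
(`diagHamiltonian_eq_fermionEmbed_localHamiltonian_add`); the latter are EVEN and supported away
from the image of every `Λ ⊆ Λ'` all of whose eight king-move neighbours lie in `Λ'`
(`thicken Λ 1 ⊆ Λ'`). With the nearest-neighbour decomposition of the tree this gives, for the
`t–t'` Hubbard torus `hubbardTorusTT' L t t' U` (`HubbardNNNHopping.lean`) and the `t–t'`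
interaction `hubbardTTPrimeFermionInteraction t t' U`:
`hubbardTorusTT' L t t' U − Γ(H^{tt'}_{Λ'})` is even and far from `Λ`
(`hubbardTorusTT'_sub_fermionEmbed_localHamiltonian_mem_carEvenSubalgebra`), so by graded locality
**`[hubbardTorusTT' L t t' U, Γ A] = Γ([H^{tt'}_{Λ'}, A])`** for every observable `A` of `Λ`
(`hubbardTorusTT'_commutator_fermionEmbed`) — the torus form of `δ(A) = i[H_{Λ'}, A]`,
Bratteli–Robinson II Thm. 6.2.4, for the `t–t'` model (R5.2 of the cell's LEAN REQUEST #5: the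
commutator null terms of a reduce-mode certificate). Everything is PROVED; no definition, no named
fact (diagonal adjacency in `ℤ²` is written out as `y = x ± (e₁ ± e₂)`).
-/

noncomputable section

namespace Literature.MathematicalPhysics.QuantumLattice

open Matrix Finset HubbardWave0 Literature.Probability.LatticeModels

/-! ### Diagonal adjacency in `ℤ²` -/

/-- Diagonal adjacency in `ℤ²` (`y = x ± (e₁ ± e₂)`), as an indicator, splits over the two diagonal
directions: `[x ~ y] T = Σ_s ([y = x + j_s] T + [x = y + j_s] T)` (at most one of the four
conditions holds). [cite: FriedliVelenik2017, §3.1] -/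
theorem ite_diagAdj_eq_sum {M : Type*} [AddCommMonoid M] (x y : Site 2) (T : M) :
    (if ((∃ s : Fin 2, y = x + diagVec s) ∨ ∃ s : Fin 2, x = y + diagVec s) then T else 0) =
      ∑ s : Fin 2, ((if y = x + diagVec s then T else 0) + (if x = y + diagVec s then T else 0)) := by
  classical
  by_cases h : (∃ s : Fin 2, y = x + diagVec s) ∨ ∃ s : Fin 2, x = y + diagVec s
  · rw [if_pos h]
    rcases h with ⟨s, hs⟩ | ⟨s, hs⟩
    · rw [Finset.sum_eq_single s]
      · subst hs
        rw [if_pos rfl, if_neg (add_diagVec_add_diagVec_ne_self x s s).symm, add_zero]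
      · intro s' _ hs's
        subst hs
        rw [if_neg, if_neg (add_diagVec_add_diagVec_ne_self x s s').symm, add_zero]
        intro h'
        exact hs's (diagVec_injective (add_left_cancel h')).symm
      · intro hs'
        exact absurd (mem_univ s) hs'
    · rw [Finset.sum_eq_single s]
      · subst hs
        rw [if_neg (add_diagVec_add_diagVec_ne_self y s s).symm, if_pos rfl, zero_add]
      · intro s' _ hs's
        subst hs
        rw [if_neg (add_diagVec_add_diagVec_ne_self y s s').symm, if_neg, add_zero]
        intro h'
        exact hs's (diagVec_injective (add_left_cancel h')).symm
      · intro hs'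
        exact absurd (mem_univ s) hs'
  · rw [if_neg h]
    refine (Finset.sum_eq_zero fun s _ => ?_).symm
    rw [if_neg, if_neg, add_zero]
    · exact fun h' => h (Or.inr ⟨s, h'⟩)
    · exact fun h' => h (Or.inl ⟨s, h'⟩)

/-- `x + j_s ∈ thicken Λ 1` for `x ∈ Λ`. [cite: FriedliVelenik2017, §3.1] -/
theorem add_diagVec_mem_thicken_one {Λ : Finset (Site 2)} {x : Site 2} (hx : x ∈ Λ) (s : Fin 2) :
    x + diagVec s ∈ thicken Λ 1 :=
  add_mem_thicken_one hx (diagVec_mem_thicken_one s)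

/-- `x - j_s ∈ thicken Λ 1` for `x ∈ Λ`. [cite: FriedliVelenik2017, §3.1] -/
theorem sub_diagVec_mem_thicken_one {Λ : Finset (Site 2)} {x : Site 2} (hx : x ∈ Λ) (s : Fin 2) :
    x - diagVec s ∈ thicken Λ 1 := by
  rw [sub_eq_add_neg]
  exact add_mem_thicken_one hx (neg_diagVec_mem_thicken_one s)

/-- **The eight king-move neighbours of `Λ` lie in `Λ'` when `thicken Λ 1 ⊆ Λ'`**: nearest
neighbours `x ± e_i` and diagonal neighbours `x ± (e₁ ± e₂)` of every `x ∈ Λ`.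
[cite: FriedliVelenik2017, §3.1] -/
theorem neighbours_mem_of_thicken_subset {Λ Λ' : Finset (Site 2)} (h8 : thicken Λ 1 ⊆ Λ') :
    (∀ x ∈ Λ, ∀ i : Fin 2, x + unitVec i ∈ Λ' ∧ x - unitVec i ∈ Λ') ∧
      ∀ x ∈ Λ, ∀ s : Fin 2, x + diagVec s ∈ Λ' ∧ x - diagVec s ∈ Λ' :=
  ⟨fun _ hx i => ⟨h8 (add_unitVec_mem_thicken_one hx i), h8 (sub_unitVec_mem_thicken_one hx i)⟩,
    fun _ hx s => ⟨h8 (add_diagVec_mem_thicken_one hx s), h8 (sub_diagVec_mem_thicken_one hx s)⟩⟩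

/-! ### Diagonal bonds of `ℤ²` in the torus -/

section Torus

variable (L : ℕ) [NeZero L]

/-- **Diagonal adjacency is preserved and reflected by the pull-back**: for `x, y ∈ Λ'` and
`x ↦ x mod L` injective on `thicken Λ' 1`, the torus sites `x mod L`, `y mod L` are diagonal
neighbours on the torus iff `x, y` are diagonal neighbours in `ℤ²`. [cite: FriedliVelenik2017, §3.1] -/
theorem fermionTorusDiagGraph_adj_ofTorusSite_proj_iff {Λ' : Finset (Site 2)}
    (hInj : Set.InjOn (Torus.proj (d := 2) L) ↑(thicken Λ' 1)) {x y : Site 2} (hx : x ∈ Λ') (hy : y ∈ Λ') :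
    (fermionTorusDiagGraph L).Adj (FermionTorus.ofTorusSite (Torus.proj L x))
        (FermionTorus.ofTorusSite (Torus.proj L y)) ↔
      (∃ s : Fin 2, y = x + diagVec s) ∨ ∃ s : Fin 2, x = y + diagVec s := by
  have proj_add : ∀ x y : Site 2, Torus.proj L (x + y) = Torus.proj L x + Torus.proj L y := fun x y => by
    funext i; simp [Torus.proj]
  rw [fermionTorusDiagGraph_adj, FermionTorus.toTorusSite_ofTorusSite, FermionTorus.toTorusSite_ofTorusSite,
    torusDiagGraph_adj_iff]
  have hx' : x ∈ (thicken Λ' 1 : Set (Site 2)) := subset_thicken Λ' 1 hx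
  have hy' : y ∈ (thicken Λ' 1 : Set (Site 2)) := subset_thicken Λ' 1 hy
  constructor
  · rintro ⟨-, ⟨s, hs⟩ | ⟨s, hs⟩⟩
    · refine Or.inl ⟨s, hInj hy' (add_diagVec_mem_thicken_one hx s) ?_⟩
      rw [proj_add, proj_diagVec, ← hs]
    · refine Or.inr ⟨s, hInj hx' (add_diagVec_mem_thicken_one hy s) ?_⟩
      rw [proj_add, proj_diagVec, ← hs]
  · rintro (⟨s, hs⟩ | ⟨s, hs⟩)
    · refine ⟨fun h => self_ne_add_diagVec x s (hInj hx' (add_diagVec_mem_thicken_one hx s) ?_), Or.inl ⟨s, ?_⟩⟩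
      · rw [← hs]; exact h
      · rw [hs, proj_add, proj_diagVec]
    · refine ⟨fun h => self_ne_add_diagVec y s (hInj hy' (add_diagVec_mem_thicken_one hy s) ?_), Or.inr ⟨s, ?_⟩⟩
      · rw [← hs]; exact h.symm
      · rw [hs, proj_add, proj_diagVec]

/-- **A diagonal torus bond touching the image of `Λ` lies inside the image of `Λ'`** when every
diagonal neighbour of `Λ` is in `Λ'`. [cite: FriedliVelenik2017, §3.1] -/
theorem mem_image_of_fermionTorusDiagGraph_adj {Λ Λ' : Finset (Site 2)}
    (hclosedD : ∀ x ∈ Λ, ∀ s : Fin 2, x + diagVec s ∈ Λ' ∧ x - diagVec s ∈ Λ') {x : Site 2} (hx : x ∈ Λ)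
    {b : FermionTorus 2 L} (hab : (fermionTorusDiagGraph L).Adj (FermionTorus.ofTorusSite (Torus.proj L x)) b) :
    b ∈ Λ'.image fun y => FermionTorus.ofTorusSite (Torus.proj L y) := by
  have proj_add : ∀ x y : Site 2, Torus.proj L (x + y) = Torus.proj L x + Torus.proj L y := fun x y => by
    funext i; simp [Torus.proj]
  have proj_sub : ∀ x y : Site 2, Torus.proj L (x - y) = Torus.proj L x - Torus.proj L y := fun x y => by
    funext i; simp [Torus.proj]
  rw [fermionTorusDiagGraph_adj, FermionTorus.toTorusSite_ofTorusSite, torusDiagGraph_adj_iff] at hab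
  obtain ⟨-, ⟨s, hs⟩ | ⟨s, hs⟩⟩ := hab
  · refine mem_image.2 ⟨x + diagVec s, (hclosedD x hx s).1, ?_⟩
    rw [proj_add, proj_diagVec, ← hs, FermionTorus.ofTorusSite_toTorusSite]
  · refine mem_image.2 ⟨x - diagVec s, (hclosedD x hx s).2, ?_⟩
    rw [proj_sub, proj_diagVec, hs, add_sub_cancel_right, FermionTorus.ofTorusSite_toTorusSite]

end Torus

/-! ### The embedded local Hamiltonian of the diagonal interaction -/

section Decomposition

variable (L : ℕ) [NeZero L] (t' : ℝ)

/-- **Support of the diagonal interaction inside a region.** If `F : Finset (Site 2) → M` vanishes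
on every `X` which is not a diagonal pair `{x, x + j_s}`, then
`Σ_{X ⊆ Λ} F X = Σ_{x ∈ Λ, s : x + j_s ∈ Λ} F {x, x + j_s}`. [cite: ArakiMoriya2003, §5.1] -/
theorem sum_powerset_eq_of_diag_support {M : Type*} [AddCommMonoid M] (Λ : Finset (Site 2))
    (F : Finset (Site 2) → M)
    (hF : ∀ X : Finset (Site 2), (∀ (x : Site 2) (s : Fin 2), X ≠ {x, x + diagVec s}) → F X = 0) :
    ∑ X ∈ Λ.powerset, F X =
      ∑ p ∈ (Λ ×ˢ (univ : Finset (Fin 2))) with p.1 + diagVec p.2 ∈ Λ, F {p.1, p.1 + diagVec p.2} := by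
  classical
  set P : Finset (Site 2 × Fin 2) := (Λ ×ˢ (univ : Finset (Fin 2))).filter fun p => p.1 + diagVec p.2 ∈ Λ
    with hP
  set S' : Finset (Finset (Site 2)) := P.image fun p => ({p.1, p.1 + diagVec p.2} : Finset (Site 2)) with hS'
  have hS'sub : S' ⊆ Λ.powerset := by
    intro X hX
    rw [hS', mem_image] at hX
    rw [mem_powerset]
    obtain ⟨p, hp, rfl⟩ := hX
    rw [hP, mem_filter, mem_product] at hp
    exact insert_subset hp.1.1 (singleton_subset_iff.2 hp.2)
  have hzero : ∀ X ∈ Λ.powerset, X ∉ S' → F X = 0 := by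
    intro X hX hXS
    rw [mem_powerset] at hX
    refine hF X (fun x s hx => hXS ?_)
    rw [hS', mem_image]
    refine ⟨(x, s), ?_, hx.symm⟩
    rw [hP, mem_filter, mem_product]
    exact ⟨⟨hX (hx ▸ mem_insert_self _ _), mem_univ _⟩, hX (hx ▸ mem_insert_of_mem (mem_singleton_self _))⟩
  rw [← Finset.sum_subset hS'sub hzero]
  have hinj : Set.InjOn (fun p : Site 2 × Fin 2 => ({p.1, p.1 + diagVec p.2} : Finset (Site 2))) ↑P := by
    rintro ⟨x, s⟩ - ⟨y, s'⟩ - h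
    dsimp only at h
    have hx : x ∈ ({y, y + diagVec s'} : Finset (Site 2)) := h ▸ mem_insert_self _ _
    have hxs : x + diagVec s ∈ ({y, y + diagVec s'} : Finset (Site 2)) := h ▸ mem_insert_of_mem (mem_singleton_self _)
    rw [mem_insert, mem_singleton] at hx hxs
    rcases hx with rfl | rfl
    · rcases hxs with h' | h'
      · exact absurd h' (self_ne_add_diagVec x s).symm
      · rw [Prod.mk.injEq]
        exact ⟨rfl, diagVec_injective (add_left_cancel h')⟩
    · rcases hxs with h' | h'
      · exact absurd h' (add_diagVec_add_diagVec_ne_self y s' s)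
      · exact absurd (add_eq_left.1 h') (diagVec_ne_zero s)
  rw [hS', Finset.sum_image hinj]

/-- **The embedded local Hamiltonian of the diagonal interaction, expanded**: `Γ(H^{t'}_{Λ'})` is the
diagonal hopping Hamiltonian of the image bonds,
`-t' Σ_{x ∼ y ∈ Λ'} Σ_σ c†_{x mod L,σ} c_{y mod L,σ}`. [cite: XuEtAl2024, eq. (1)] -/
theorem fermionEmbed_toTorusEmb_diag_localHamiltonian {Λ' : Finset (Site 2)}
    (h : Set.InjOn (Torus.proj (d := 2) L) ↑Λ') :
    fermionEmbed (PolySite.toTorusEmb L h) ((diagHoppingFermionInteraction t').localHamiltonian Λ') =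
      -(t' : ℂ) • ∑ x ∈ Λ', ∑ y ∈ Λ', (if ((∃ s : Fin 2, y = x + diagVec s) ∨ ∃ s : Fin 2, x = y + diagVec s) then
          ∑ σ : Fin 2, creation (orb (FermionTorus.ofTorusSite (Torus.proj L x)) σ) *
            annihilation (orb (FermionTorus.ofTorusSite (Torus.proj L y)) σ) else 0) := by
  classical
  set hop : Site 2 → Site 2 → Matrix (Finset (Orb (FermionTorus 2 L))) (Finset (Orb (FermionTorus 2 L))) ℂ :=
    fun x y => ∑ σ : Fin 2, creation (orb (FermionTorus.ofTorusSite (Torus.proj L x)) σ) *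
      annihilation (orb (FermionTorus.ofTorusSite (Torus.proj L y)) σ) with hhop
  -- images of the generators under `Γ(ι ∘ incl)`
  have hc : ∀ {X : Finset (Site 2)} (hX : X ⊆ Λ') (x : Site 2) (hx : x ∈ X) (σ : Fin 2),
      fermionEmbed ((PolySite.incl hX).trans (PolySite.toTorusEmb L h)) (cAt x hx σ) =
        annihilation (orb (FermionTorus.ofTorusSite (Torus.proj L x)) σ) := by
    intro X hX x hx σ
    rw [cAt, fermionEmbed_annihilation]
    rfl
  have hcd : ∀ {X : Finset (Site 2)} (hX : X ⊆ Λ') (x : Site 2) (hx : x ∈ X) (σ : Fin 2),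
      fermionEmbed ((PolySite.incl hX).trans (PolySite.toTorusEmb L h)) ((cAt x hx σ)ᴴ) =
        creation (orb (FermionTorus.ofTorusSite (Torus.proj L x)) σ) := by
    intro X hX x hx σ
    rw [cAt, annihilation_conjTranspose, fermionEmbed_creation]
    rfl
  -- (1) the left-hand side over the diagonal bonds of `Λ'`
  have hL : fermionEmbed (PolySite.toTorusEmb L h) ((diagHoppingFermionInteraction t').localHamiltonian Λ') =
      -(t' : ℂ) • ∑ x ∈ Λ', ∑ s : Fin 2,
        (if x + diagVec s ∈ Λ' then hop x (x + diagVec s) + hop (x + diagVec s) x else 0) := by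
    rw [FermionInteraction.localHamiltonian_eq_sum, fermionEmbed_sum,
      sum_powerset_eq_of_diag_support Λ' _ (fun X hX => by
        by_cases h' : X ⊆ Λ'
        · rw [dif_pos h', diagHoppingFermionInteraction_apply_eq_zero t' hX, fermionEmbed_zero, fermionEmbed_zero]
        · rw [dif_neg h', fermionEmbed_zero]),
      Finset.sum_filter, Finset.sum_product, Finset.smul_sum]
    refine Finset.sum_congr rfl fun x hx => ?_
    rw [Finset.smul_sum]
    refine Finset.sum_congr rfl fun s _ => ?_
    by_cases hs : x + diagVec s ∈ Λ'
    · have hsub : ({x, x + diagVec s} : Finset (Site 2)) ⊆ Λ' := insert_subset hx (singleton_subset_iff.2 hs)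
      rw [if_pos hs, if_pos hs, dif_pos hsub, fermionEmbed_fermionEmbed, diagHoppingFermionInteraction_apply_pair,
        fermionEmbed_smul, fermionEmbed_sum, hhop]
      simp only [← Finset.sum_add_distrib]
      congr 1
      refine Finset.sum_congr rfl fun σ _ => ?_
      rw [fermionEmbed_add, fermionEmbed_mul, fermionEmbed_mul, hc, hc, hcd, hcd]
    · rw [if_neg hs, if_neg hs, smul_zero]
  -- (2) the right-hand side over the diagonal bonds of `Λ'`
  have hR : ∑ x ∈ Λ', ∑ y ∈ Λ', (if ((∃ s : Fin 2, y = x + diagVec s) ∨ ∃ s : Fin 2, x = y + diagVec s) then hop x y else 0) =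
      ∑ x ∈ Λ', ∑ s : Fin 2, (if x + diagVec s ∈ Λ' then hop x (x + diagVec s) + hop (x + diagVec s) x else 0) := by
    simp_rw [ite_diagAdj_eq_sum]
    have hswap : ∀ x : Site 2,
        ∑ y ∈ Λ', ∑ s : Fin 2, ((if y = x + diagVec s then hop x y else 0) +
            (if x = y + diagVec s then hop x y else 0)) =
          ∑ s : Fin 2, ∑ y ∈ Λ', ((if y = x + diagVec s then hop x y else 0) +
            (if x = y + diagVec s then hop x y else 0)) := fun x => Finset.sum_comm
    simp_rw [hswap]
    rw [Finset.sum_comm]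
    conv_rhs => rw [Finset.sum_comm]
    refine Finset.sum_congr rfl fun s _ => ?_
    simp only [Finset.sum_add_distrib]
    have h1 : ∀ x : Site 2, ∑ y ∈ Λ', (if y = x + diagVec s then hop x y else 0) =
        if x + diagVec s ∈ Λ' then hop x (x + diagVec s) else 0 := fun x => by
      rw [Finset.sum_ite_eq' Λ' (x + diagVec s) (fun y => hop x y)]
    have h2 : ∑ x ∈ Λ', ∑ y ∈ Λ', (if x = y + diagVec s then hop x y else 0) =
        ∑ y ∈ Λ', if y + diagVec s ∈ Λ' then hop (y + diagVec s) y else 0 := by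
      rw [Finset.sum_comm]
      exact Finset.sum_congr rfl fun y _ => by rw [Finset.sum_ite_eq' Λ' (y + diagVec s) (fun x => hop x y)]
    simp_rw [h1]
    rw [h2, ← Finset.sum_add_distrib]
    refine Finset.sum_congr rfl fun x _ => ?_
    by_cases h' : x + diagVec s ∈ Λ'
    · rw [if_pos h', if_pos h', if_pos h']
    · rw [if_neg h', if_neg h', if_neg h', add_zero]
  rw [hL, hR]

/-- **`H^{t'}_L = Γ(H^{t'}_{Λ'}) + far terms`**: for `x ↦ x mod L` injective on `thicken Λ' 1`, the
diagonal hopping Hamiltonian of the torus is the embedded free-boundary local Hamiltonian of the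
diagonal interaction on `Λ'` plus the hopping terms of the diagonal torus bonds not inside the
image `I'` of `Λ'`. [cite: BratteliRobinsonII1997, §6.2.1 (H_Λ' = H_Λ + W)] -/
theorem diagHamiltonian_eq_fermionEmbed_localHamiltonian_add {Λ' : Finset (Site 2)}
    (hInj : Set.InjOn (Torus.proj (d := 2) L) ↑(thicken Λ' 1)) :
    hamiltonian (fermionTorusDiagGraph L) t' 0 =
      fermionEmbed (PolySite.toTorusEmb L (hInj.mono (by exact_mod_cast subset_thicken Λ' 1)))
          ((diagHoppingFermionInteraction t').localHamiltonian Λ') +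
        (-(t' : ℂ) • ∑ a : FermionTorus 2 L, ∑ b : FermionTorus 2 L,
            (if ¬(a ∈ Λ'.image (fun x => FermionTorus.ofTorusSite (Torus.proj L x)) ∧
                b ∈ Λ'.image (fun x => FermionTorus.ofTorusSite (Torus.proj L x))) then
              ∑ σ : Fin 2, (if (fermionTorusDiagGraph L).Adj a b then creation (orb a σ) * annihilation (orb b σ) else 0)
            else 0)) := by
  have hInj' : Set.InjOn (Torus.proj (d := 2) L) ↑Λ' := hInj.mono (by exact_mod_cast subset_thicken Λ' 1)
  have hι : Set.InjOn (fun x : Site 2 => FermionTorus.ofTorusSite (Torus.proj L x)) ↑Λ' :=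
    injOn_ofTorusSite_proj L hInj'
  rw [fermionEmbed_toTorusEmb_diag_localHamiltonian, hamiltonian, Complex.ofReal_zero, zero_smul, add_zero]
  -- split each term according to whether the bond lies in the image of `Λ'`
  have hsplit : ∀ a b : FermionTorus 2 L,
      (∑ σ : Fin 2, (if (fermionTorusDiagGraph L).Adj a b then creation (orb a σ) * annihilation (orb b σ) else 0)) =
        (if a ∈ Λ'.image (fun x => FermionTorus.ofTorusSite (Torus.proj L x)) ∧
            b ∈ Λ'.image (fun x => FermionTorus.ofTorusSite (Torus.proj L x)) then
          ∑ σ : Fin 2, (if (fermionTorusDiagGraph L).Adj a b then creation (orb a σ) * annihilation (orb b σ) else 0)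
          else 0) +
        (if ¬(a ∈ Λ'.image (fun x => FermionTorus.ofTorusSite (Torus.proj L x)) ∧
            b ∈ Λ'.image (fun x => FermionTorus.ofTorusSite (Torus.proj L x))) then
          ∑ σ : Fin 2, (if (fermionTorusDiagGraph L).Adj a b then creation (orb a σ) * annihilation (orb b σ) else 0)
          else 0) := by
    intro a b
    by_cases hab : a ∈ Λ'.image (fun x => FermionTorus.ofTorusSite (Torus.proj L x)) ∧
        b ∈ Λ'.image (fun x => FermionTorus.ofTorusSite (Torus.proj L x))
    · rw [if_pos hab, if_neg (not_not.2 hab), add_zero]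
    · rw [if_neg hab, if_pos hab, zero_add]
  -- the bonds inside the image are the images of the bonds of `Λ'`
  have hin : ∑ a : FermionTorus 2 L, ∑ b : FermionTorus 2 L,
      (if a ∈ Λ'.image (fun x => FermionTorus.ofTorusSite (Torus.proj L x)) ∧
          b ∈ Λ'.image (fun x => FermionTorus.ofTorusSite (Torus.proj L x)) then
        ∑ σ : Fin 2, (if (fermionTorusDiagGraph L).Adj a b then creation (orb a σ) * annihilation (orb b σ) else 0)
        else 0) =
      ∑ x ∈ Λ', ∑ y ∈ Λ', (if ((∃ s : Fin 2, y = x + diagVec s) ∨ ∃ s : Fin 2, x = y + diagVec s) then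
          ∑ σ : Fin 2, creation (orb (FermionTorus.ofTorusSite (Torus.proj L x)) σ) *
            annihilation (orb (FermionTorus.ofTorusSite (Torus.proj L y)) σ) else 0) := by
    calc ∑ a : FermionTorus 2 L, ∑ b : FermionTorus 2 L,
          (if a ∈ Λ'.image (fun x => FermionTorus.ofTorusSite (Torus.proj L x)) ∧
              b ∈ Λ'.image (fun x => FermionTorus.ofTorusSite (Torus.proj L x)) then
            ∑ σ : Fin 2, (if (fermionTorusDiagGraph L).Adj a b then creation (orb a σ) * annihilation (orb b σ) else 0)
            else 0)
        = ∑ a : FermionTorus 2 L, (if a ∈ Λ'.image (fun x => FermionTorus.ofTorusSite (Torus.proj L x)) then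
            ∑ b ∈ Λ'.image (fun x => FermionTorus.ofTorusSite (Torus.proj L x)),
              ∑ σ : Fin 2, (if (fermionTorusDiagGraph L).Adj a b then creation (orb a σ) * annihilation (orb b σ) else 0)
            else 0) := by
          refine Finset.sum_congr rfl fun a _ => ?_
          by_cases ha : a ∈ Λ'.image (fun x => FermionTorus.ofTorusSite (Torus.proj L x))
          · simp only [ha, true_and, if_true]
            rw [Finset.sum_ite_mem, Finset.univ_inter]
          · simp only [ha, false_and, if_false, Finset.sum_const_zero]
      _ = ∑ a ∈ Λ'.image (fun x => FermionTorus.ofTorusSite (Torus.proj L x)),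
            ∑ b ∈ Λ'.image (fun x => FermionTorus.ofTorusSite (Torus.proj L x)),
              ∑ σ : Fin 2, (if (fermionTorusDiagGraph L).Adj a b then creation (orb a σ) * annihilation (orb b σ) else 0) := by
          rw [Finset.sum_ite_mem, Finset.univ_inter]
      _ = ∑ x ∈ Λ', ∑ y ∈ Λ', ∑ σ : Fin 2,
            (if (fermionTorusDiagGraph L).Adj (FermionTorus.ofTorusSite (Torus.proj L x))
                (FermionTorus.ofTorusSite (Torus.proj L y)) then
              creation (orb (FermionTorus.ofTorusSite (Torus.proj L x)) σ) *
                annihilation (orb (FermionTorus.ofTorusSite (Torus.proj L y)) σ) else 0) := by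
          rw [Finset.sum_image hι]
          exact Finset.sum_congr rfl fun x _ => Finset.sum_image hι
      _ = _ := by
          refine Finset.sum_congr rfl fun x hx => Finset.sum_congr rfl fun y hy => ?_
          by_cases hxy : (∃ s : Fin 2, y = x + diagVec s) ∨ ∃ s : Fin 2, x = y + diagVec s
          · rw [if_pos hxy]
            exact Finset.sum_congr rfl fun σ _ =>
              if_pos ((fermionTorusDiagGraph_adj_ofTorusSite_proj_iff L hInj hx hy).2 hxy)
          · rw [if_neg hxy]
            exact Finset.sum_eq_zero fun σ _ =>
              if_neg fun h' => hxy ((fermionTorusDiagGraph_adj_ofTorusSite_proj_iff L hInj hx hy).1 h')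
  have hhop : ∑ a : FermionTorus 2 L, ∑ b : FermionTorus 2 L, ∑ σ : Fin 2,
        (if (fermionTorusDiagGraph L).Adj a b then creation (orb a σ) * annihilation (orb b σ) else 0) =
      ∑ x ∈ Λ', ∑ y ∈ Λ', (if ((∃ s : Fin 2, y = x + diagVec s) ∨ ∃ s : Fin 2, x = y + diagVec s) then
          ∑ σ : Fin 2, creation (orb (FermionTorus.ofTorusSite (Torus.proj L x)) σ) *
            annihilation (orb (FermionTorus.ofTorusSite (Torus.proj L y)) σ) else 0) +
        ∑ a : FermionTorus 2 L, ∑ b : FermionTorus 2 L,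
            (if ¬(a ∈ Λ'.image (fun x => FermionTorus.ofTorusSite (Torus.proj L x)) ∧
                b ∈ Λ'.image (fun x => FermionTorus.ofTorusSite (Torus.proj L x))) then
              ∑ σ : Fin 2, (if (fermionTorusDiagGraph L).Adj a b then creation (orb a σ) * annihilation (orb b σ) else 0)
            else 0) := by
    rw [← hin, ← Finset.sum_add_distrib]
    refine Finset.sum_congr rfl fun a _ => ?_
    rw [← Finset.sum_add_distrib]
    exact Finset.sum_congr rfl fun b _ => hsplit a b
  rw [hhop, smul_add]

/-- A diagonal torus bond touching the image of `Λ ⊆ Λ'` lies inside the image of `Λ'`, when every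
diagonal neighbour of a site of `Λ` is in `Λ'`. [cite: FriedliVelenik2017, §3.1] -/
theorem mem_image_and_mem_image_of_diagAdj {Λ Λ' : Finset (Site 2)} (hΛ : Λ ⊆ Λ')
    (hclosedD : ∀ x ∈ Λ, ∀ s : Fin 2, x + diagVec s ∈ Λ' ∧ x - diagVec s ∈ Λ') {c c' : FermionTorus 2 L}
    (hcc' : (fermionTorusDiagGraph L).Adj c c') (hc : c ∈ Λ.image fun x => FermionTorus.ofTorusSite (Torus.proj L x)) :
    c ∈ Λ'.image (fun x => FermionTorus.ofTorusSite (Torus.proj L x)) ∧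
      c' ∈ Λ'.image (fun x => FermionTorus.ofTorusSite (Torus.proj L x)) := by
  obtain ⟨x, hx, rfl⟩ := Finset.mem_image.1 hc
  exact ⟨Finset.mem_image.2 ⟨x, hΛ hx, rfl⟩, mem_image_of_fermionTorusDiagGraph_adj L hclosedD hx hcc'⟩

omit [NeZero L] in
/-- The hopping term of a diagonal torus bond avoiding the image of `Λ` is even and supported away
from it. [cite: BratteliRobinsonII1997, §5.2.2] -/
theorem sum_ite_diagAdj_mem_carEvenSubalgebra [NeZero L] {I : Finset (FermionTorus 2 L)} {a b : FermionTorus 2 L}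
    (h : (fermionTorusDiagGraph L).Adj a b → a ∉ I ∧ b ∉ I) :
    (∑ σ : Fin 2, (if (fermionTorusDiagGraph L).Adj a b then creation (orb a σ) * annihilation (orb b σ) else 0)) ∈
      carEvenSubalgebra (orbs I)ᶜ := by
  by_cases hadj : (fermionTorusDiagGraph L).Adj a b
  · refine sum_mem fun σ _ => ?_
    rw [if_pos hadj]
    exact creation_mul_annihilation_mem_carEvenSubalgebra
      (Finset.mem_compl.2 fun h' => (h hadj).1 (orb_mem_orbs.1 h'))
      (Finset.mem_compl.2 fun h' => (h hadj).2 (orb_mem_orbs.1 h'))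
  · rw [Finset.sum_eq_zero fun σ _ => if_neg hadj]
    exact zero_mem _

/-- **The far diagonal hopping terms are even and supported away from the image of `Λ`.**
[cite: BratteliRobinsonII1997, §5.2.2] -/
theorem far_diag_hopping_mem_carEvenSubalgebra {Λ Λ' : Finset (Site 2)} (hΛ : Λ ⊆ Λ')
    (hclosedD : ∀ x ∈ Λ, ∀ s : Fin 2, x + diagVec s ∈ Λ' ∧ x - diagVec s ∈ Λ') :
    (∑ a : FermionTorus 2 L, ∑ b : FermionTorus 2 L,
        (if ¬(a ∈ Λ'.image (fun x => FermionTorus.ofTorusSite (Torus.proj L x)) ∧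
            b ∈ Λ'.image (fun x => FermionTorus.ofTorusSite (Torus.proj L x))) then
          ∑ σ : Fin 2, (if (fermionTorusDiagGraph L).Adj a b then creation (orb a σ) * annihilation (orb b σ) else 0)
        else 0)) ∈
      carEvenSubalgebra (orbs (Λ.image fun x => FermionTorus.ofTorusSite (Torus.proj L x)))ᶜ := by
  refine sum_mem fun a _ => sum_mem fun b _ => ?_
  by_cases hab : ¬(a ∈ Λ'.image (fun x => FermionTorus.ofTorusSite (Torus.proj L x)) ∧
      b ∈ Λ'.image (fun x => FermionTorus.ofTorusSite (Torus.proj L x)))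
  · rw [if_pos hab]
    refine sum_ite_diagAdj_mem_carEvenSubalgebra L fun hadj => ⟨fun ha => hab ?_, fun hb => hab ?_⟩
    · exact mem_image_and_mem_image_of_diagAdj L hΛ hclosedD hadj ha
    · exact (mem_image_and_mem_image_of_diagAdj L hΛ hclosedD hadj.symm hb).symm
  · rw [if_neg hab]
    exact zero_mem _

/-- **`H^{t'}_L - Γ(H^{t'}_{Λ'})` is even and far from `Λ`**: the difference of the diagonal hopping
Hamiltonian of the torus and the embedded local Hamiltonian of the diagonal interaction on
`Λ' ⊇ Λ` (all diagonal neighbours of `Λ` in `Λ'`, `x ↦ x mod L` injective on `thicken Λ' 1`) lies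
in the even CAR subalgebra of the orbitals away from the image of `Λ`.
[cite: BratteliRobinsonII1997, §6.2.1 and §5.2.2] -/
theorem diagHamiltonian_sub_fermionEmbed_localHamiltonian_mem_carEvenSubalgebra {Λ Λ' : Finset (Site 2)}
    (hΛ : Λ ⊆ Λ') (hclosedD : ∀ x ∈ Λ, ∀ s : Fin 2, x + diagVec s ∈ Λ' ∧ x - diagVec s ∈ Λ')
    (hInj : Set.InjOn (Torus.proj (d := 2) L) ↑(thicken Λ' 1)) :
    hamiltonian (fermionTorusDiagGraph L) t' 0 -
        fermionEmbed (PolySite.toTorusEmb L (hInj.mono (by exact_mod_cast subset_thicken Λ' 1)))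
          ((diagHoppingFermionInteraction t').localHamiltonian Λ') ∈
      carEvenSubalgebra (orbs (Λ.image fun x => FermionTorus.ofTorusSite (Torus.proj L x)))ᶜ := by
  rw [diagHamiltonian_eq_fermionEmbed_localHamiltonian_add L t' hInj, add_sub_cancel_left]
  exact SMulMemClass.smul_mem _ (far_diag_hopping_mem_carEvenSubalgebra L hΛ hclosedD)

end Decomposition

/-! ### The `t–t'` torus Hamiltonian near an embedded region -/

section TTPrime

variable (L : ℕ) [NeZero L] (t t' U : ℝ)

/-- **`H^{tt'}_L - Γ(H^{tt'}_{Λ'})` is even and far from `Λ`**: if `Λ ⊆ Λ'`, all eight king-move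
neighbours of every site of `Λ` lie in `Λ'` (`thicken Λ 1 ⊆ Λ'`) and `x ↦ x mod L` is injective on
`thicken Λ' 1`, then the difference of the `t–t'` torus Hamiltonian `hubbardTorusTT' L t t' U` and
the embedded local Hamiltonian of the `t–t'` interaction on `Λ'` belongs to the even CAR subalgebra
of the orbitals over the complement of the image of `Λ`.
[cite: BratteliRobinsonII1997, §6.2.1 and §5.2.2] -/
theorem hubbardTorusTT'_sub_fermionEmbed_localHamiltonian_mem_carEvenSubalgebra {Λ Λ' : Finset (Site 2)}
    (hΛ : Λ ⊆ Λ') (h8 : thicken Λ 1 ⊆ Λ')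
    (hInj : Set.InjOn (Torus.proj (d := 2) L) ↑(thicken Λ' 1)) :
    hubbardTorusTT' L t t' U -
        fermionEmbed (PolySite.toTorusEmb L (hInj.mono (by exact_mod_cast subset_thicken Λ' 1)))
          ((hubbardTTPrimeFermionInteraction t t' U).localHamiltonian Λ') ∈
      carEvenSubalgebra (orbs (Λ.image fun x => FermionTorus.ofTorusSite (Torus.proj L x)))ᶜ := by
  obtain ⟨hclosed, hclosedD⟩ := neighbours_mem_of_thicken_subset h8
  rw [hubbardTTPrimeFermionInteraction_localHamiltonian, fermionEmbed_add, hubbardTorusTT']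
  have e : hamiltonian (fermionTorusGraph 2 L) t U + hamiltonian (fermionTorusDiagGraph L) t' 0 -
      (fermionEmbed (PolySite.toTorusEmb L (hInj.mono (by exact_mod_cast subset_thicken Λ' 1)))
          ((hubbardFermionInteraction 2 t U).localHamiltonian Λ') +
        fermionEmbed (PolySite.toTorusEmb L (hInj.mono (by exact_mod_cast subset_thicken Λ' 1)))
          ((diagHoppingFermionInteraction t').localHamiltonian Λ')) =
      (hubbardTorus 2 L t U -
          fermionEmbed (PolySite.toTorusEmb L (hInj.mono (by exact_mod_cast subset_thicken Λ' 1)))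
            ((hubbardFermionInteraction 2 t U).localHamiltonian Λ')) +
        (hamiltonian (fermionTorusDiagGraph L) t' 0 -
          fermionEmbed (PolySite.toTorusEmb L (hInj.mono (by exact_mod_cast subset_thicken Λ' 1)))
            ((diagHoppingFermionInteraction t').localHamiltonian Λ')) := by
    rw [hubbardTorus]
    abel
  rw [e]
  exact add_mem (hubbardTorus_sub_fermionEmbed_localHamiltonian_mem_carEvenSubalgebra L t U hΛ hclosed hInj)
    (diagHamiltonian_sub_fermionEmbed_localHamiltonian_mem_carEvenSubalgebra L t' hΛ hclosedD hInj)

/-- **Graded locality on the torus**: `H^{tt'}_L - Γ(H^{tt'}_{Λ'})` commutes with every embedded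
observable of `Λ`. [cite: BratteliRobinsonII1997, §5.2.2] -/
theorem commute_hubbardTorusTT'_sub_fermionEmbed_localHamiltonian {Λ Λ' : Finset (Site 2)}
    (hΛ : Λ ⊆ Λ') (h8 : thicken Λ 1 ⊆ Λ')
    (hInj : Set.InjOn (Torus.proj (d := 2) L) ↑(thicken Λ' 1)) (A : FermionOp Λ) :
    Commute (hubbardTorusTT' L t t' U -
        fermionEmbed (PolySite.toTorusEmb L (hInj.mono (by exact_mod_cast subset_thicken Λ' 1)))
          ((hubbardTTPrimeFermionInteraction t t' U).localHamiltonian Λ'))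
      (fermionEmbed (PolySite.toTorusEmb L (hInj.mono (by exact_mod_cast subset_thicken Λ' 1)))
        (fermionEmbed (PolySite.incl hΛ) A)) := by
  rw [fermionEmbed_fermionEmbed]
  refine commute_of_mem_carEvenSubalgebra
    (hubbardTorusTT'_sub_fermionEmbed_localHamiltonian_mem_carEvenSubalgebra L t t' U hΛ h8 hInj)
    (fermionEmbed_mem_carSubalgebra _ A) ?_
  exact disjoint_compl_left_iff.2 (orbs_map_incl_trans_toTorusEmb_subset L hΛ _)

/-- **The commutator with the `t–t'` torus Hamiltonian is the embedded local commutator**: for an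
observable `A` of `Λ`, embedded into the torus through `Λ' ⊇ Λ` (`Λ'` containing all eight
king-move neighbours of `Λ`, `x ↦ x mod L` injective on `thicken Λ' 1`),
`[H^{tt'}_L, Γ A] = Γ([H^{tt'}_{Λ'}, A])` — the torus form of `δ(A) = i[H_{Λ'}, A]`,
Bratteli–Robinson II Thm. 6.2.4, for the `t–t'` Hubbard model; the commutator null terms of a
reduce-mode certificate (Han 2020 §3, `F[[H, O]] = 0`). [cite: BratteliRobinsonII1997, Thm. 6.2.4] -/
theorem hubbardTorusTT'_commutator_fermionEmbed {Λ Λ' : Finset (Site 2)}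
    (hΛ : Λ ⊆ Λ') (h8 : thicken Λ 1 ⊆ Λ')
    (hInj : Set.InjOn (Torus.proj (d := 2) L) ↑(thicken Λ' 1)) (A : FermionOp Λ) :
    hubbardTorusTT' L t t' U *
          fermionEmbed (PolySite.toTorusEmb L (hInj.mono (by exact_mod_cast subset_thicken Λ' 1)))
            (fermionEmbed (PolySite.incl hΛ) A) -
        fermionEmbed (PolySite.toTorusEmb L (hInj.mono (by exact_mod_cast subset_thicken Λ' 1)))
            (fermionEmbed (PolySite.incl hΛ) A) * hubbardTorusTT' L t t' U =
      fermionEmbed (PolySite.toTorusEmb L (hInj.mono (by exact_mod_cast subset_thicken Λ' 1)))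
        ((hubbardTTPrimeFermionInteraction t t' U).localHamiltonian Λ' * fermionEmbed (PolySite.incl hΛ) A -
          fermionEmbed (PolySite.incl hΛ) A * (hubbardTTPrimeFermionInteraction t t' U).localHamiltonian Λ') := by
  have hc := commute_hubbardTorusTT'_sub_fermionEmbed_localHamiltonian L t t' U hΛ h8 hInj A
  rw [Commute, SemiconjBy, sub_mul, mul_sub, sub_eq_sub_iff_sub_eq_sub] at hc
  rw [fermionEmbed_sub, fermionEmbed_mul, fermionEmbed_mul]
  exact hc

end TTPrime

end Literature.MathematicalPhysics.QuantumLattice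

end
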